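import Mathlib
import HarnessLib
import Summits.NavierStokesRegularity.NavierStokesRegularity.Theorems.PoloidalWindowDoorPoloidalWindowRigidityZShockHeightEvolution

/-!
# Crux K2 `PoloidalWindowRigidity` (stmt-NavierStokesRegularity-19708), line `z_shock` — the THICK autonomous height-evolution with the
# LOGARITHMIC slope law is the SU(∞) Toda / Boyer–Finley / dispersionless 2D Toda equation `(e^u)_zz = u_xx + u_yy`

`--supports stmt-NavierStokesRegularity-19708 --as helper` (leafhand-ns-poloidalwindowdoor-3 g18, cell decomp-ns, 2026-09-01).  Def-free,
class-free calculus over the tree theorem `…ZShockHeightEvolution.heightEvolution_of_slope_function`.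
**No stub and no summit is closed by this file; Navier–Stokes regularity is NOT proved here (rung 0).**

## What is identified

On the autonomous THICK hyperbolic column of line `z_shock` a slice `f = v(t₀,·)` obeys, on every connected open part of its non-degenerate
set, a slope law `∂_z f_b = G(f₂)·∂_b f₂` (`b = 0,1`) with ONE real-analytic `G` (`…ZShockSlopeFunctionConnected`), and then the autonomous
height-evolution `∂₂²f₂ = −(G(f₂)Δₕf₂ + G'(f₂)|∇ₕf₂|²)`, i.e. `w_zz + Δₕ𝒢(w) = 0`, `𝒢' = G` (`…ZShockHeightEvolution`); hyperbolic =
`G < 0`, THICK (genuinely nonlinear) = `G' ≠ 0`.  The deciding stub is reduced to the class-free slice Liouville statement `hGN` about such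
fields (`…ZShockAutReduction`, `…ZShockAutOfSliceLiouville`), booked by every census as «R3: two-sided eternal rigidity of a genuinely
nonlinear 2+1-D wave equation in the height — XL, not in print».

This file records that the sub-family of LOGARITHMIC slope antiderivatives — `G(s) = 1/s` on `s < 0`, `𝒢(s) = log(−s)` (and, by the affine
and scaling symmetries `w ↦ αw + β`, `z ↦ λz` of the height-evolution, every `G(s) = a/(s − s₀)`), which is HYPERBOLIC AND GENUINELY
NONLINEAR AT EVERY NON-DEGENERATE POINT (`G < 0`, `G' = −1/s² ≠ 0`) — is an INTEGRABLE model: with `u := log(−f₂)` (so `f₂ = −e^u`)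
the height-evolution is VERBATIM the SU(∞) Toda equation (Boyer–Finley 1982; «dispersionless 2D Toda», wave form
`(exp φ)_tt = φ_xx + φ_yy` of Manakov–Santini, J. Phys. A 42 (2009) 095203, arXiv:0810.4676, eq. (2); the height `z` is their time `t` —
the line's lens «the height as time» literally):

* `laplaceH_log_neg` — second horizontal partials of `u = log(−f₂)`: `∂_b∂_b u = f₂⁻¹·∂_b∂_b f₂ − f₂⁻²·(∂_b f₂)²` (`b = 0, 1`), on `{f₂ < 0}`.
* ★ `toda_of_logSlope` — real-analytic divergence-free `f` on `ℝ³`, an open `U ⊆ {f₂ < 0}` on which `∂_z f_b = f₂⁻¹·∂_b f₂` (`b = 0,1`):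
  at every point of `U`, `∂₂∂₂(e^u) = ∂₀∂₀u + ∂₁∂₁u` for `u = log(−f₂)`.
* `hypDiscriminant_of_logSlope` / `gnDefect_of_logSlope` — under the log law the stubs' hyperbolicity discriminant is `f₂⁻¹·|∇ₕf₂|²`
  (strictly negative at every point with `∇ₕf₂ ≠ 0`) and `hGN`'s genuine-nonlinearity defect in direction `p` is
  `−f₂⁻²·(∂_b f₂)²·Df₂[p]` (non-zero at every point with `∂_b f₂ ≠ 0`, taking `p = e_b`): in this sub-family the three point-clauses of
  `hGN` (hyperbolic / genuinely nonlinear / twisting point) collapse to «one point with `∇ₕf₂ ≠ 0`» + «one twisting point».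

## Why it is recorded (planner- / disprover-facing; nothing here is claimed to close anything)

(1) For the integrable member the eternal-solution question behind R3 has LITERATURE: Manakov–Santini solve the Cauchy problem of
`(e^u)_zz = Δₕu` by the inverse spectral transform for one-parameter families of vector fields and show that localized initial data BREAK
(gradient catastrophe) at finite height, and that small data break in the long-height regime (loc. cit. §§3–4) — in-print support, in
2+1 dimensions and beyond Alinhac's small-data theorem, for the line's mechanism; no Liouville theorem for bounded NON-decaying two-sided
data is in print even here, so R3/`hGN` stay open.  (2) Conversely every real-analytic solution `u` of the SU(∞) Toda equation on a region,
with a horizontal potential `φ` (`∂_zφ = u`, `Δₕφ = −∂_z(−e^u)`), gives the e₃-poloidal divergence-free field `(∇ₕφ, −e^u)` obeying the log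
slope law, so the explicit solution zoo of this equation (separable `e^u = (1 − z²)·4|h'|²/(1+|h|²)²` over Liouville's equation — all
UNTWISTED, `∇ₕu_z = 0`; the rotationally symmetric ones ↔ axisymmetric harmonic functions (Ward 1990) — untwisted; the non-invariant
families of the mathematical-physics literature) is the natural catalogue in which to hunt an inhabitant of `hGN` (needed: ENTIRE on `ℝ³`,
`e^u`, `e^u|∇u|`, `∇ₕφ`, `D∇ₕφ` bounded, one point with `∇ₕu_z ∦ ∇ₕu`).  Neither direction is asserted beyond the identities proved below.
HONEST LABEL: S-sized identification; closes no stub; crux 19708 OPEN.  presearch: «Boyer–Finley / SU(∞) Toda / dispersionless 2D Toda»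
→ [corpus: arXiv:0810.4676 pp.2–4,10] equation and breaking results; no mention of this identification in the crux records
(`Cruxes/PoloidalWindowRigidity/**`: 0 hits for Toda / Boyer–Finley / dispersionless). [cite: ManakovSantini2009, eq. (2) and §4]
-/

noncomputable section

namespace Summit.NavierStokesRegularity.NavierStokesRegularity.Theorems.PoloidalWindowDoorPoloidalWindowRigidityZShockTodaForm

-- the problem directory repeats the summit name (`NavierStokesRegularity/NavierStokesRegularity`)
set_option linter.dupNamespace false

open Set Filter Topology Function
open Literature.Analysis Literature.Analysis.FluidPDE
open Summit.NavierStokesRegularity.NavierStokesRegularity.Theorems.PoloidalWindowDoorPoloidalWindowRigidityZShockHeightEvolution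
  (heightEvolution_of_slope_function)
open Summit.NavierStokesRegularity.NavierStokesRegularity.Theorems.PoloidalWindowDoorPoloidalWindowRigidityZShockAutonomyGlobal
  (analyticOnNhd_coord analyticOnNhd_fderiv_apply)
open Summit.NavierStokesRegularity.NavierStokesRegularity.Theorems.PoloidalWindowDoorPoloidalWindowRigidityHorizontalSourceGauge
  (analyticOnNhd_fderiv_apply_coord)

variable {f : EuclideanSpace ℝ (Fin 3) → EuclideanSpace ℝ (Fin 3)}

/-! ## Calculus of `u = log(−f₂)` -/

/-- First derivative of `u = log(−f₂)` at a point where `f₂ < 0`: `Du = f₂⁻¹·Df₂`. [folklore] -/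
theorem hasFDerivAt_log_neg (hf : AnalyticOnNhd ℝ f univ) {y : EuclideanSpace ℝ (Fin 3)} (hy : f y 2 < 0) :
    HasFDerivAt (fun z => Real.log (-(f z 2))) ((f y 2)⁻¹ • fderiv ℝ (fun z => f z 2) y) y := by
  have hw : DifferentiableAt ℝ (fun z => f z 2) y := (analyticOnNhd_coord hf 2 y (mem_univ _)).differentiableAt
  have hneg : HasFDerivAt (fun z => -(f z 2)) (-(fderiv ℝ (fun z => f z 2) y)) y := hw.hasFDerivAt.neg
  have hlog : HasDerivAt Real.log (-(f y 2))⁻¹ (-(f y 2)) := Real.hasDerivAt_log (by linarith)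
  have hc := hlog.comp_hasFDerivAt y hneg
  have hEq : ((-(f y 2))⁻¹ • -fderiv ℝ (fun z => f z 2) y) = (f y 2)⁻¹ • fderiv ℝ (fun z => f z 2) y := by
    ext v
    simp only [_root_.smul_apply, _root_.neg_apply, smul_eq_mul]
    rw [inv_neg]
    ring
  rw [hEq] at hc
  exact hc

/-- On the open set `{f₂ < 0}` the partial `∂_e u` of `u = log(−f₂)` is the function `f₂⁻¹·∂_e f₂`. [folklore] -/
theorem fderiv_log_neg_apply (hf : AnalyticOnNhd ℝ f univ) {y : EuclideanSpace ℝ (Fin 3)} (hy : f y 2 < 0)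
    (e : EuclideanSpace ℝ (Fin 3)) :
    fderiv ℝ (fun z => Real.log (-(f z 2))) y e = (f y 2)⁻¹ * fderiv ℝ f y e 2 := by
  rw [(hasFDerivAt_log_neg hf hy).fderiv, _root_.smul_apply, smul_eq_mul,
    fderiv_apply_coord_vec3 (hf y (mem_univ _)).differentiableAt 2 e]

/-- **Second partials of `u = log(−f₂)`** along a fixed direction `e`, at a point of the open set `{f₂ < 0}`:
`∂_e∂_e u = f₂⁻¹·∂_e∂_e f₂ − f₂⁻²·(∂_e f₂)²`. [folklore] -/
theorem laplaceH_log_neg (hf : AnalyticOnNhd ℝ f univ) {x : EuclideanSpace ℝ (Fin 3)} (hx : f x 2 < 0)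
    (e : EuclideanSpace ℝ (Fin 3)) :
    fderiv ℝ (fun y => fderiv ℝ (fun z => Real.log (-(f z 2))) y e) x e =
      (f x 2)⁻¹ * fderiv ℝ (fun y => fderiv ℝ f y e 2) x e - ((f x 2) ^ 2)⁻¹ * (fderiv ℝ f x e 2) ^ 2 := by
  -- `{f₂ < 0}` is an open neighbourhood of `x`, on which `∂_e u = f₂⁻¹·∂_e f₂`
  have hw_an : AnalyticOnNhd ℝ (fun z => f z 2) univ := analyticOnNhd_coord hf 2
  have hw : ∀ y, DifferentiableAt ℝ (fun z => f z 2) y := fun y => (hw_an y (mem_univ _)).differentiableAt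
  have hopen : IsOpen {y : EuclideanSpace ℝ (Fin 3) | f y 2 < 0} :=
    isOpen_lt (continuousOn_univ.1 hw_an.continuousOn) continuous_const
  have hEq : (fun y => fderiv ℝ (fun z => Real.log (-(f z 2))) y e) =ᶠ[𝓝 x]
      fun y => (f y 2)⁻¹ * fderiv ℝ f y e 2 := by
    filter_upwards [hopen.mem_nhds hx] with y hy
    exact fderiv_log_neg_apply hf hy e
  rw [hEq.fderiv_eq]
  -- product rule for `f₂⁻¹ · ∂_e f₂`
  have hinv : HasFDerivAt (fun y => (f y 2)⁻¹) ((-((f x 2) ^ 2)⁻¹) • fderiv ℝ (fun z => f z 2) x) x :=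
    (hasDerivAt_inv (ne_of_lt hx)).comp_hasFDerivAt x (hw x).hasFDerivAt
  have hD : HasFDerivAt (fun y => fderiv ℝ f y e 2) (fderiv ℝ (fun y => fderiv ℝ f y e 2) x) x :=
    (analyticOnNhd_fderiv_apply_coord hf e 2 x (mem_univ _)).differentiableAt.hasFDerivAt
  rw [(hinv.fun_mul hD).fderiv]
  simp only [_root_.add_apply, _root_.smul_apply, smul_eq_mul]
  rw [fderiv_apply_coord_vec3 (hf x (mem_univ _)).differentiableAt 2 e]
  ring

/-! ## The Toda form of the height-evolution under the logarithmic slope law -/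

/-- ★ **SU(∞) Toda / Boyer–Finley form.**  Let `f : ℝ³ → ℝ³` be real-analytic and divergence-free, and let `U` be an open set on which
`f₂ < 0` and the vertical shear obeys the LOGARITHMIC slope law `∂_z f_b = f₂⁻¹·∂_b f₂` (`b = 0, 1`; slope function `G(s) = 1/s`,
antiderivative `𝒢(s) = log(−s)`: hyperbolic and genuinely nonlinear at every non-degenerate point).  Then `u := log(−f₂)` satisfies the
dispersionless 2D Toda equation `∂₂∂₂(e^u) = ∂₀∂₀u + ∂₁∂₁u` at every point of `U` (Manakov–Santini's `(exp φ)_tt = φ_xx + φ_yy` with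
`t = x₂`). [cite: ManakovSantini2009, eq. (2)] -/
theorem toda_of_logSlope (hf : AnalyticOnNhd ℝ f univ) (hdiv : VectorCalculus.IsDivFree f)
    {U : Set (EuclideanSpace ℝ (Fin 3))} (hU : IsOpen U) (hneg : ∀ y ∈ U, f y 2 < 0)
    (hslope : ∀ y ∈ U, ∀ b : Fin 3, b ≠ 2 →
      fderiv ℝ f y (EuclideanSpace.single 2 1) b = (f y 2)⁻¹ * fderiv ℝ f y (EuclideanSpace.single b 1) 2)
    {x : EuclideanSpace ℝ (Fin 3)} (hx : x ∈ U) :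
    fderiv ℝ (fun y => fderiv ℝ (fun z => Real.exp (Real.log (-(f z 2)))) y (EuclideanSpace.single 2 1)) x
        (EuclideanSpace.single 2 1) =
      fderiv ℝ (fun y => fderiv ℝ (fun z => Real.log (-(f z 2))) y (EuclideanSpace.single 0 1)) x
          (EuclideanSpace.single 0 1) +
        fderiv ℝ (fun y => fderiv ℝ (fun z => Real.log (-(f z 2))) y (EuclideanSpace.single 1 1)) x
          (EuclideanSpace.single 1 1) := by
  set e0 : EuclideanSpace ℝ (Fin 3) := EuclideanSpace.single 0 1 with he0
  set e1 : EuclideanSpace ℝ (Fin 3) := EuclideanSpace.single 1 1 with he1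
  set e2 : EuclideanSpace ℝ (Fin 3) := EuclideanSpace.single 2 1 with he2
  have hw_an : AnalyticOnNhd ℝ (fun z => f z 2) univ := analyticOnNhd_coord hf 2
  -- the height-evolution with `G(s) = s⁻¹`, `G'(s) = −(s²)⁻¹`
  have hHE := heightEvolution_of_slope_function hf hdiv (G := fun s => s⁻¹) (G' := fun s => -((s ^ 2)⁻¹)) hU
    (fun y hy => hasDerivAt_inv (ne_of_lt (hneg y hy))) hslope hx
  -- left-hand side: `e^u = −f₂` near `x`
  have hEq1 : (fun z => Real.exp (Real.log (-(f z 2)))) =ᶠ[𝓝 x] fun z => -(f z 2) := by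
    filter_upwards [hU.mem_nhds hx] with z hz
    exact Real.exp_log (by linarith [hneg z hz])
  have hEq2 : (fun y => fderiv ℝ (fun z => Real.exp (Real.log (-(f z 2)))) y e2) =ᶠ[𝓝 x]
      fun y => -(fderiv ℝ (fun z => f z 2) y e2) := by
    have hEq1' : ∀ᶠ y in 𝓝 x, (fun z => Real.exp (Real.log (-(f z 2)))) =ᶠ[𝓝 y] fun z => -(f z 2) := by
      filter_upwards [hU.mem_nhds hx] with y hy
      filter_upwards [hU.mem_nhds hy] with z hz
      exact Real.exp_log (by linarith [hneg z hz])
    filter_upwards [hEq1'] with y hy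
    rw [hy.fderiv_eq, fderiv_fun_neg, _root_.neg_apply]
  have hL : fderiv ℝ (fun y => fderiv ℝ (fun z => Real.exp (Real.log (-(f z 2)))) y e2) x e2 =
      -(fderiv ℝ (fun y => fderiv ℝ f y e2 2) x e2) := by
    rw [hEq2.fderiv_eq, fderiv_fun_neg, _root_.neg_apply]
    have hfun : (fun y => fderiv ℝ (fun z => f z 2) y e2) = fun y => fderiv ℝ f y e2 2 := by
      funext y
      exact fderiv_apply_coord_vec3 (hf y (mem_univ _)).differentiableAt 2 e2
    rw [hfun]
  -- right-hand side: the two horizontal second partials of `u`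
  rw [hL, hHE, laplaceH_log_neg hf (hneg x hx) e0, laplaceH_log_neg hf (hneg x hx) e1]
  ring

/-! ## The point-clauses of `hGN` under the logarithmic slope law -/

/-- **Hyperbolicity discriminant under the log law**: `∂_z f₀·∂₀f₂ + ∂_z f₁·∂₁f₂ = f₂⁻¹·((∂₀f₂)² + (∂₁f₂)²)`; in particular it is
strictly negative at every point with `f₂ < 0` and `∇ₕf₂ ≠ 0` (pure algebra). [folklore] -/
theorem hypDiscriminant_of_logSlope {y : EuclideanSpace ℝ (Fin 3)}
    (hslope : ∀ b : Fin 3, b ≠ 2 →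
      fderiv ℝ f y (EuclideanSpace.single 2 1) b = (f y 2)⁻¹ * fderiv ℝ f y (EuclideanSpace.single b 1) 2) :
    fderiv ℝ f y (EuclideanSpace.single 2 1) 0 * fderiv ℝ f y (EuclideanSpace.single 0 1) 2 +
        fderiv ℝ f y (EuclideanSpace.single 2 1) 1 * fderiv ℝ f y (EuclideanSpace.single 1 1) 2 =
      (f y 2)⁻¹ * (fderiv ℝ f y (EuclideanSpace.single 0 1) 2 ^ 2 + fderiv ℝ f y (EuclideanSpace.single 1 1) 2 ^ 2) := by
  rw [hslope 0 (by decide), hslope 1 (by decide)]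
  ring

/-- Under the log law every point with `f₂ < 0` and `∇ₕf₂ ≠ 0` is STRICTLY HYPERBOLIC. [folklore] -/
theorem hyperbolic_of_logSlope {y : EuclideanSpace ℝ (Fin 3)} (hneg : f y 2 < 0)
    (hslope : ∀ b : Fin 3, b ≠ 2 →
      fderiv ℝ f y (EuclideanSpace.single 2 1) b = (f y 2)⁻¹ * fderiv ℝ f y (EuclideanSpace.single b 1) 2)
    (hnd : fderiv ℝ f y (EuclideanSpace.single 0 1) 2 ≠ 0 ∨ fderiv ℝ f y (EuclideanSpace.single 1 1) 2 ≠ 0) :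
    fderiv ℝ f y (EuclideanSpace.single 2 1) 0 * fderiv ℝ f y (EuclideanSpace.single 0 1) 2 +
        fderiv ℝ f y (EuclideanSpace.single 2 1) 1 * fderiv ℝ f y (EuclideanSpace.single 1 1) 2 < 0 := by
  rw [hypDiscriminant_of_logSlope hslope]
  have hpos : 0 < fderiv ℝ f y (EuclideanSpace.single 0 1) 2 ^ 2 + fderiv ℝ f y (EuclideanSpace.single 1 1) 2 ^ 2 := by
    rcases hnd with h | h
    · have := pow_pos (abs_pos.2 h) 2
      rw [sq_abs] at this
      positivity
    · have := pow_pos (abs_pos.2 h) 2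
      rw [sq_abs] at this
      positivity
  exact mul_neg_of_neg_of_pos (inv_lt_zero.2 hneg) hpos

/-- **`hGN`'s genuine-nonlinearity defect under the log law.**  On an open set `U ⊆ {f₂ < 0}` carrying the log slope law, for `b = 0, 1`
and every direction `p`:
`∂_b f₂·D(∂_z f_b)[p] − ∂_z f_b·D(∂_b f₂)[p] = −f₂⁻²·(∂_b f₂)²·Df₂[p]` (the slope function's `G'(f₂)(∂_bf₂)²Df₂[p]` with `G' = −1/s²`).
[folklore] -/
theorem gnDefect_of_logSlope (hf : AnalyticOnNhd ℝ f univ)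
    {U : Set (EuclideanSpace ℝ (Fin 3))} (hU : IsOpen U) (hneg : ∀ y ∈ U, f y 2 < 0)
    (hslope : ∀ y ∈ U, ∀ b : Fin 3, b ≠ 2 →
      fderiv ℝ f y (EuclideanSpace.single 2 1) b = (f y 2)⁻¹ * fderiv ℝ f y (EuclideanSpace.single b 1) 2)
    {x : EuclideanSpace ℝ (Fin 3)} (hx : x ∈ U) {b : Fin 3} (hb : b ≠ 2) (p : EuclideanSpace ℝ (Fin 3)) :
    fderiv ℝ f x (EuclideanSpace.single b 1) 2 *
          fderiv ℝ (fun y => fderiv ℝ f y (EuclideanSpace.single 2 1) b) x p -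
        fderiv ℝ f x (EuclideanSpace.single 2 1) b *
          fderiv ℝ (fun y => fderiv ℝ f y (EuclideanSpace.single b 1) 2) x p =
      -(((f x 2) ^ 2)⁻¹ * (fderiv ℝ f x (EuclideanSpace.single b 1) 2) ^ 2 * fderiv ℝ f x p 2) := by
  set eb : EuclideanSpace ℝ (Fin 3) := EuclideanSpace.single b 1 with heb
  set e2 : EuclideanSpace ℝ (Fin 3) := EuclideanSpace.single 2 1 with he2
  have hw : ∀ y, DifferentiableAt ℝ (fun z => f z 2) y :=
    fun y => (analyticOnNhd_coord hf 2 y (mem_univ _)).differentiableAt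
  -- `∂_z f_b = f₂⁻¹·∂_b f₂` near `x`
  have hEq : (fun y => fderiv ℝ f y e2 b) =ᶠ[𝓝 x] fun y => (f y 2)⁻¹ * fderiv ℝ f y eb 2 := by
    filter_upwards [hU.mem_nhds hx] with y hy
    exact hslope y hy b hb
  rw [hEq.fderiv_eq]
  have hinv : HasFDerivAt (fun y => (f y 2)⁻¹) ((-((f x 2) ^ 2)⁻¹) • fderiv ℝ (fun z => f z 2) x) x :=
    (hasDerivAt_inv (ne_of_lt (hneg x hx))).comp_hasFDerivAt x (hw x).hasFDerivAt
  have hD : HasFDerivAt (fun y => fderiv ℝ f y eb 2) (fderiv ℝ (fun y => fderiv ℝ f y eb 2) x) x :=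
    (analyticOnNhd_fderiv_apply_coord hf eb 2 x (mem_univ _)).differentiableAt.hasFDerivAt
  rw [(hinv.fun_mul hD).fderiv]
  simp only [_root_.add_apply, _root_.smul_apply, smul_eq_mul]
  rw [fderiv_apply_coord_vec3 (hf x (mem_univ _)).differentiableAt 2 p, hslope x hx b hb]
  ring

/-- Under the log law every point of `U` with `∂_b f₂ ≠ 0` is GENUINELY NONLINEAR in `hGN`'s sense (direction `p = e_b`):
the defect equals `−f₂⁻²·(∂_b f₂)³ ≠ 0`. [folklore] -/
theorem gnPoint_of_logSlope (hf : AnalyticOnNhd ℝ f univ)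
    {U : Set (EuclideanSpace ℝ (Fin 3))} (hU : IsOpen U) (hneg : ∀ y ∈ U, f y 2 < 0)
    (hslope : ∀ y ∈ U, ∀ b : Fin 3, b ≠ 2 →
      fderiv ℝ f y (EuclideanSpace.single 2 1) b = (f y 2)⁻¹ * fderiv ℝ f y (EuclideanSpace.single b 1) 2)
    {x : EuclideanSpace ℝ (Fin 3)} (hx : x ∈ U) {b : Fin 3} (hb : b ≠ 2)
    (hnd : fderiv ℝ f x (EuclideanSpace.single b 1) 2 ≠ 0) :
    fderiv ℝ f x (EuclideanSpace.single b 1) 2 *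
          fderiv ℝ (fun y => fderiv ℝ f y (EuclideanSpace.single 2 1) b) x (EuclideanSpace.single b 1) -
        fderiv ℝ f x (EuclideanSpace.single 2 1) b *
          fderiv ℝ (fun y => fderiv ℝ f y (EuclideanSpace.single b 1) 2) x (EuclideanSpace.single b 1) ≠ 0 := by
  rw [gnDefect_of_logSlope hf hU hneg hslope hx hb]
  have h2 : f x 2 ≠ 0 := ne_of_lt (hneg x hx)
  have : ((f x 2) ^ 2)⁻¹ * fderiv ℝ f x (EuclideanSpace.single b 1) 2 ^ 2 *
      fderiv ℝ f x (EuclideanSpace.single b 1) 2 ≠ 0 := by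
    apply mul_ne_zero (mul_ne_zero _ (pow_ne_zero 2 hnd)) hnd
    exact inv_ne_zero (pow_ne_zero 2 h2)
  exact neg_ne_zero.2 this

end Summit.NavierStokesRegularity.NavierStokesRegularity.Theorems.PoloidalWindowDoorPoloidalWindowRigidityZShockTodaForm
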